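import Literature.AnabelianGeometry.SemiGraphs.ArithOuterActionCongruenceTreeLevelChart
import Literature.AnabelianGeometry.SemiGraphs.UniversalCoveringOverAutDescent
import Literature.AnabelianGeometry.SemiGraphs.TemperedPiLevelKernelVerticial
import Literature.AnabelianGeometry.SemiGraphs.TemperedPiPresentationTowerInputs
import Literature.AnabelianGeometry.SemiGraphs.GaloisLevelDataChart
import HarnessLib

/-!
# [SemiAnbd] Def 5.1 (i)(c^new) / Prop 5.2 (i): the T54 capstone binder `hCCt` PRODUCED at the chart of a cofinal
# Galois tower with characteristic levels — level inputs discharged (the «T54-HCCT-PRODUCER»; proof-only)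

Mochizuki, *Semi-graphs of anabelioids*, Publ. RIMS **42** (2006) 221–322, §5: Def 5.1 (i) p. 62, Prop 5.2 (i) p. 63 and
its proof p. 64 l. 67–74 («… follow from the various finiteness assumptions in our definition of a "continuous
action"»), Prop 3.6 (iii) p. 39 («`Gal(H'_i/G)` is residually finite»), Thm 3.7 (iii) p. 41, Thm 5.4 p. 66.
[cite: MochizukiSemiAnbd2006, Prop 5.2 (i), p. 63]

PROOF-ONLY file (abc-iut cell, layer L3, row «T54-HCCT-PRODUCER» of abc-iut-L3-lead δ7 (7) / δ23; seat abc-iut-w4-d085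
gen 10).  No definition, no instance, no new named fact.  The three LEVEL INPUTS displayed by this seat's
`GaloisLevelData.exists_nhds_forall_rep_congr_ker_projAut` (`ArithOuterActionCongruenceTreeLevelChart.lean`) are
theorems of the tree and are plugged here BY NAME:
(L1) `Gal(𝒢_{∞,n}/𝒢)` — hence its subgroup `π₁^temp(𝒢) ⧸ ker projAut n` — is residually finite: abc-iut-L3-t6's
`CovObj.residuallyFinite_aut_univCoverOver` (free-by-finite, `UniversalCoveringOverAutDescent.lean`), the rigidity of
endomorphisms of a connected level being `CovHom.ext_of_sameComponent`; (L2) the vertex / edge groups of the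
presentation have finite image modulo the OPEN tree level: they are compact (abc-iut-w4-d053's
`isCompact_piPresentation_H` / `_M`, `TemperedPiPresentationTowerInputs.lean`) and the quotient is discrete
(`isOpen_ker_projAut`); (L3) the level-`ker projAut n` coset semi-graph is a tree (abc-iut-w4-d059's
`piPresentation_hT`, `TemperedPiLevelKernelVerticial.lean`), hence connected.

* `GaloisLevelData.hCCt_of_forall_finiteIndex_isOpen` — **THE PRODUCER**: for a cofinal Galois tower `D` with connected
  finite levels whose finite-level kernels are the characteristic open cores `charOpenCore (d n)` with UNBOUNDED `d`, an
  outer action `ρ : Π_A →* Out_top(π₁^temp(𝒢))` of a STRONGLY COMPLETE COMPACT `Π_A` (Def 5.1 (i)(a) + (O3)) with a base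
  action on the finite graph `𝔾`, and the presentation `D.piPresentation T R` `IsArithCompatible` for
  `π₁^temp(𝒢) ⋊^out Π_A` (the PRODUCED branch transport, p460259, through the capstones'
  `isArithCompatible_piPresentation_outerAction_of_branchPair_chart_of_finite`):
  `∀ n, ∃ U ∈ 𝓝 1, ∀ a ∈ U, ∃ φ, TopOut.mk φ = ρ a ∧ ∀ y, φ y · y⁻¹ ∈ ker (D.projAut n)` — VERBATIM the binder `hCCt`
  of `ArithThm54CharCoresCapstoneV9` (p488210, `(D.chart …).G = D.temperedPi` by `GaloisLevelData.chart_G`) with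
  `n₁ := 0`.

HONEST LABEL: this produces the DESIGN datum `hCCt` of the T54 outer model from hsc + compactness of `Π_A` + the
coherence frame + the (produced) arithmetic compatibility — print's «finiteness» argument in kernel form; the
capstone's other residual binders (`hrep`/`F`/`θ`, `hsc`, `hinst`, `noSwitchBase`, `hest`, …) are untouched; nothing here
asserts a result of [SemiAnbd] for a genuine curve; no side taken on [IUTchIII] Cor. 3.12; typed ≠ proved.
-/

namespace Literature.AnabelianGeometry.SemiGraphs

namespace ProfiniteSemiGraph

namespace GaloisLevelData

open CategoryTheory Topology Filter Literature.AnabelianGeometry.EtaleTheta SemiGraph SemiGraph.SubgroupPresentation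
open scoped Pointwise

universe u v

variable {𝒢 : ProfiniteSemiGraph.{u}}

/-- **The T54 capstone binder `hCCt`, PRODUCED** ([SemiAnbd] Def 5.1 (i)(c^new) / Prop 5.2 (i) at the chart of a
cofinal Galois tower with characteristic levels): tempered congruence-continuity of ANY outer action of a strongly
complete compact `Π_A` modulo EVERY tree level `ker (D.projAut n)`, given the arithmetic compatibility of the
presentation (= the produced branch transport).  See the module docstring.
[cite: MochizukiSemiAnbd2006, Prop 5.2 (i), p. 63] -/
theorem hCCt_of_forall_finiteIndex_isOpen (D : GaloisLevelData 𝒢) (h𝒢 : 𝒢.IsCountable)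
    (hconn : ∀ (n : ℕ) (p q : (D.S n).Point), (D.S n).SameComponent p q) (hfin : ∀ n, (D.S n).IsFinite)
    (T : ∀ w : 𝒢.graph.Vertex, D.PointSeq h𝒢 w) (R : SemiGraph.RefBranches 𝒢.graph)
    {PA : Type v} [Group PA] [TopologicalSpace PA] [IsTopologicalGroup PA] [CompactSpace PA]
    (ρ : PA →* TopOut (D.temperedPi h𝒢)) (baseAct : PA →* Aut 𝒢.graph)
    [Finite 𝒢.graph.Vertex] [Finite 𝒢.graph.Edge] [Finite 𝒢.graph.Branch]
    (hP : (D.piPresentation h𝒢 T R).IsArithCompatible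
      (((contMulAut (D.temperedPi h𝒢)).subtype.comp (MonoidHom.fst (contMulAut (D.temperedPi h𝒢)) PA)).comp
        (outerSemidirectProduct ρ).subtype) (baseAct.comp (outerSemidirectProductSnd ρ)))
    (d : ℕ → ℕ) (hker : ∀ n, (D.piLevelAut h𝒢 hconn n).ker = charOpenCore (D.temperedPi h𝒢) (d n))
    (hd : ∀ N : ℕ, ∃ m, N ≤ d m)
    (hsc : ∀ H : Subgroup PA, H.FiniteIndex → IsOpen (H : Set PA)) :
    ∀ n : ℕ, ∃ U ∈ 𝓝 (1 : PA), ∀ a ∈ U, ∃ φ : contMulAut (D.temperedPi h𝒢), TopOut.mk _ φ = ρ a ∧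
      ∀ y : D.temperedPi h𝒢, (φ : MulAut (D.temperedPi h𝒢)) y * y⁻¹ ∈ (D.projAut h𝒢 n).ker := by
  intro n
  -- (L1) residual finiteness of `Gal(𝒢_{∞,n}/𝒢)` and of the image of `π₁^temp(𝒢)` in it
  haveI : Finite (((D.S n).SV D.v₀).obj.V) := (hfin n).finite_V D.v₀
  haveI : Group.ResiduallyFinite (Aut (D.cover h𝒢 n)) :=
    CovObj.residuallyFinite_aut_univCoverOver (D.S n) D.v₀ (D.x n) h𝒢 (fun x => D.htrans n D.v₀ (D.x n) x)
      (fun σ σ' h => CovHom.ext_of_sameComponent σ σ' (Sum.inl ⟨D.v₀, D.x n⟩) (hconn n _)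
        (by change Sum.inl _ = Sum.inl _; rw [h]))
  have hrf : Group.ResiduallyFinite (D.temperedPi h𝒢 ⧸ (D.projAut h𝒢 n).ker) :=
    Literature.GroupTheory.CombinatorialGroupTheory.residuallyFinite_of_injective (QuotientGroup.kerLift (D.projAut h𝒢 n)) (QuotientGroup.kerLift_injective _)
  -- (L2) finite images of the compact vertex / edge groups modulo the open tree level
  haveI : DiscreteTopology (D.temperedPi h𝒢 ⧸ (D.projAut h𝒢 n).ker) :=
    QuotientGroup.discreteTopology (D.isOpen_ker_projAut h𝒢 n)
  have hH : ∀ w : 𝒢.graph.Vertex, ((QuotientGroup.mk (s := (D.projAut h𝒢 n).ker)) ''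
      ((D.piPresentation h𝒢 T R).H w : Set (D.temperedPi h𝒢))).Finite := fun w =>
    ((D.isCompact_piPresentation_H h𝒢 T R w).image QuotientGroup.continuous_mk).finite_of_discrete
  have hM : ∀ ε : 𝒢.graph.Edge, ((QuotientGroup.mk (s := (D.projAut h𝒢 n).ker)) ''
      ((D.piPresentation h𝒢 T R).M ε : Set (D.temperedPi h𝒢))).Finite := fun ε =>
    ((D.isCompact_piPresentation_M h𝒢 T R ε).image QuotientGroup.continuous_mk).finite_of_discrete
  -- (L3) the tree level is a tree, hence connected
  have hconnK : ((D.piPresentation h𝒢 T R).cosetGraph (D.projAut h𝒢 n).ker).IsConnected :=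
    ⟨(D.piPresentation_hT h𝒢 T R n).isTree.connected⟩
  exact D.exists_nhds_forall_rep_congr_ker_projAut h𝒢 hconn hfin T R ρ baseAct hP d hker hd hsc n hrf hH hM hconnK

/-- The same, phrased over the CHART of the tower (`(D.chart …).G`, which IS `D.temperedPi` — `GaloisLevelData.chart_G`):
the literal binder shape of the T54 capstones' chart-level theorems. [cite: MochizukiSemiAnbd2006, Prop 5.2 (i), p. 63] -/
theorem hCCt_chart_of_forall_finiteIndex_isOpen (D : GaloisLevelData 𝒢) (h𝒢 : 𝒢.IsCountable)
    (hcof : ∀ (X : CovObj 𝒢), X.IsTempered → ∀ p : X.Point, ∃ i : ℕ, ∀ j, i ≤ j → (D.S j).Splits (X.component p))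
    (hcn : 𝒢.graph.IsConnected) (hS : ∀ n, (D.S n).Splits (D.S n)) (hfin : ∀ n, (D.S n).IsFinite)
    (hne : ∀ n, (D.S n).HasNonemptyFibres)
    (hconn : ∀ (n : ℕ) (p q : (D.S n).Point), (D.S n).SameComponent p q)
    (T : ∀ w : 𝒢.graph.Vertex, D.PointSeq h𝒢 w) (R : SemiGraph.RefBranches 𝒢.graph)
    {PA : Type v} [Group PA] [TopologicalSpace PA] [IsTopologicalGroup PA] [CompactSpace PA]
    (ρ : PA →* TopOut (D.chart h𝒢 hcof hcn hS hfin hne).G) (baseAct : PA →* Aut 𝒢.graph)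
    [Finite 𝒢.graph.Vertex] [Finite 𝒢.graph.Edge] [Finite 𝒢.graph.Branch]
    (hP : (D.piPresentation h𝒢 T R).IsArithCompatible
      (((contMulAut (D.chart h𝒢 hcof hcn hS hfin hne).G).subtype.comp
        (MonoidHom.fst (contMulAut (D.chart h𝒢 hcof hcn hS hfin hne).G) PA)).comp
        (outerSemidirectProduct ρ).subtype) (baseAct.comp (outerSemidirectProductSnd ρ)))
    (d : ℕ → ℕ) (hker : ∀ n, (D.piLevelAut h𝒢 hconn n).ker = charOpenCore (D.temperedPi h𝒢) (d n))
    (hd : ∀ N : ℕ, ∃ m, N ≤ d m)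
    (hsc : ∀ H : Subgroup PA, H.FiniteIndex → IsOpen (H : Set PA)) :
    ∀ n : ℕ, ∃ U ∈ 𝓝 (1 : PA), ∀ a ∈ U, ∃ φ : contMulAut (D.chart h𝒢 hcof hcn hS hfin hne).G,
      TopOut.mk (D.chart h𝒢 hcof hcn hS hfin hne).G φ = ρ a ∧
      ∀ y : (D.chart h𝒢 hcof hcn hS hfin hne).G,
        (φ : MulAut (D.chart h𝒢 hcof hcn hS hfin hne).G) y * y⁻¹ ∈ (D.projAut h𝒢 n).ker :=
  D.hCCt_of_forall_finiteIndex_isOpen h𝒢 hconn hfin T R ρ baseAct hP d hker hd hsc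

end GaloisLevelData

end ProfiniteSemiGraph

end Literature.AnabelianGeometry.SemiGraphs
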